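import Literature.AnabelianGeometry.EtaleTheta.SettingModelGfpRigidity
import Literature.AnabelianGeometry.EtaleTheta.SettingModel2
import Literature.AnabelianGeometry.EtaleTheta.TemperedRigidity
import HarnessLib

/-!
# [EtTh] Thm. 1.6 (i) HOLDS at the finer model `ThetaSetting.model₂ p`, for every `Δ`-preserving `γ`

Mochizuki, *The étale theta function …*, Publ. RIMS **45** (2009) [EtTh], Thm. 1.6 (i) p. 24:
«We have: γ(Π^tp_{Ÿα}) = Π^tp_{Ÿβ}». abc-iut cell, layer L2, seat abc-iut-w5-d051 (gen 3;
SUBDAG-EtTh-Thm16 lineage). PROOF-ONLY (no definition, no named fact), over abc-iut-L2-t1's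
`ThetaSetting.model₂ p` (`Π^tp_X := Γ × G_{ℚ_p}`, `Γ = F̂₂ ×_Ẑ ℤ`, `G_{ℚ_p}` discrete, `K = ℚ_p`,
`q_X = p²`; `SettingModel2`) and `SettingModelGfpRigidity` (`map_dY_eq`, `center_gfp_eq_bot`).

At the ROOT model `Π^tp_X = F₂ × G_{ℚ_p}` (everything discrete) the typed sentence
`ThetaSetting.Thm16i γ` FAILS for the `Δ`-preserving swap `a ↔ b`
(`SettingModelThm16iIndependence.exists_deltaPreserving_not_thm16i`, ROW R44 «K3 at the root model»).
This file shows the failure is an artefact of discreteness: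

* `snd_apply_mk_one`, `fst_apply_one_mk`, `apply_eq_prod` — a topological automorphism `γ` of
  `Π^tp_X = Γ × G_{ℚ_p}` with `γ(Δ^tp_X) = Δ^tp_X` is a PRODUCT `γ₁ × α`: the `Γ`-component of
  `γ(1, σ)` commutes with the whole `Γ`-slice, and `Γ` is centre-free; `exists_slice` packages the
  slice `γ₁` as a topological automorphism of `Γ`;
* `fieldKN_bot_qModel_two_mul_one`, `fieldJddN_bot_qModel_one`, `mem_GtpYdd_model₂_iff` — with
  `q_X = p²`: `K₂ = ℚ_p(ζ₂, q_X^{1/2}) = ℚ_p = J̈₁`, so `Π^tp_Ÿ = Δ^tp_{Y₂} × G_{ℚ_p}`;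
* **`model₂_thm16i`** — hence `ThetaSetting.Thm16i γ` at `Dα = Dβ = ThetaSetting.model₂ p` for EVERY
  `Δ`-preserving `γ` (`γ₁` preserves `Δ^tp_{Y₂}` by `map_dY_eq`), and
  `ThetaSetting.exists_isEtThOrigin_and_forall_thm16i`: root + guard + «Thm. 1.6 (i) for all
  `Δ`-preserving `γ`» are jointly satisfiable — although `IsThm16Origin` (abc-iut-L2-t6's origin clauses,
  the hypothesis of the K3 chain) is NOT available at this cusp-free model. The conclusion of Thm. 1.6 (i)
  is thus kernel-consistent at a non-discrete model; the origin clauses are sufficient, not necessary.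

Consistency evidence about a semi-synthetic model only; nothing of [EtTh] is asserted for the genuine
tempered fundamental groups; no side is taken on [IUTchIII] Cor. 3.12; typed ≠ proved.
-/

noncomputable section

namespace Literature.AnabelianGeometry.EtaleTheta.SettingModel

open Literature.AnabelianGeometry.SemiGraphs Function Topology

/-! ### 5. `Δ`-preserving topological automorphisms of `Π^tp_X = Γ × G_{ℚ_p}` are products -/

section Model

variable (p : ℕ) [Fact p.Prime]

/-- A `Δ`-preserving automorphism keeps the `Γ × 1`-slice. [cite: MochizukiEtTh2009, Thm 1.6 (i) p.24] -/
theorem snd_apply_mk_one (γ : PiTp₂ p ≃ₜ* PiTp₂ p)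
    (hΔ : (curve₂ p).DeltaTemp.map γ.toMulEquiv.toMonoidHom = (curve₂ p).DeltaTemp) (x : Gfp) :
    (γ (x, 1)).2 = 1 := by
  have h : γ (x, 1) ∈ (curve₂ p).DeltaTemp.map γ.toMulEquiv.toMonoidHom :=
    ⟨(x, 1), (mem_deltaTemp₂_iff p _).mpr rfl, rfl⟩
  rw [hΔ] at h
  exact (mem_deltaTemp₂_iff p _).mp h

/-- The inverse of a `Δ`-preserving automorphism is `Δ`-preserving. [cite: MochizukiEtTh2009, Thm 1.6 (i) p.24] -/
theorem map_deltaTemp_symm_eq (γ : PiTp₂ p ≃ₜ* PiTp₂ p)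
    (hΔ : (curve₂ p).DeltaTemp.map γ.toMulEquiv.toMonoidHom = (curve₂ p).DeltaTemp) :
    (curve₂ p).DeltaTemp.map γ.symm.toMulEquiv.toMonoidHom = (curve₂ p).DeltaTemp := by
  have h1 : (curve₂ p).DeltaTemp.map γ.symm.toMulEquiv.toMonoidHom =
      (curve₂ p).DeltaTemp.comap γ.toMulEquiv.toMonoidHom := by
    ext g
    rw [Subgroup.mem_comap]
    constructor
    · rintro ⟨h, hh, rfl⟩
      change γ (γ.symm h) ∈ (curve₂ p).DeltaTemp
      rw [γ.apply_symm_apply]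
      exact hh
    · intro hg
      exact ⟨γ g, hg, γ.symm_apply_apply g⟩
  calc (curve₂ p).DeltaTemp.map γ.symm.toMulEquiv.toMonoidHom
      = (curve₂ p).DeltaTemp.comap γ.toMulEquiv.toMonoidHom := h1
    _ = ((curve₂ p).DeltaTemp.map γ.toMulEquiv.toMonoidHom).comap γ.toMulEquiv.toMonoidHom := by
        rw [hΔ]
    _ = (curve₂ p).DeltaTemp :=
        Subgroup.comap_map_eq_self_of_injective (f := γ.toMulEquiv.toMonoidHom)
          (fun a b h => γ.injective h) _

/-- Surjectivity of the `Γ`-slice map `x ↦ (γ (x,1)).1`. [cite: MochizukiEtTh2009, Thm 1.6 (i) p.24] -/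
theorem exists_fst_apply_mk_one_eq (γ : PiTp₂ p ≃ₜ* PiTp₂ p)
    (hΔ : (curve₂ p).DeltaTemp.map γ.toMulEquiv.toMonoidHom = (curve₂ p).DeltaTemp) (y : Gfp) :
    ∃ x : Gfp, γ (x, 1) = (y, 1) := by
  have hy : ((y, 1) : PiTp₂ p) ∈ (curve₂ p).DeltaTemp.map γ.toMulEquiv.toMonoidHom := by
    rw [hΔ]; exact (mem_deltaTemp₂_iff p _).mpr rfl
  obtain ⟨d, hd, hdy⟩ := hy
  refine ⟨d.1, ?_⟩
  have hd2 : d.2 = 1 := (mem_deltaTemp₂_iff p d).mp hd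
  have : d = (d.1, 1) := Prod.ext rfl hd2
  rw [← this]; exact hdy

/-- **The arithmetic slice is untouched on the `Γ`-side**: for a `Δ`-preserving topological automorphism
`γ` of `Π^tp_X = Γ × G_{ℚ_p}` and `σ ∈ G_{ℚ_p}`, `(γ (1, σ)).1 = 1` — it commutes with the whole
`Γ`-slice and `Γ` is centre-free. [cite: MochizukiEtTh2009, Thm 1.6 (i) p.24] -/
theorem fst_apply_one_mk (γ : PiTp₂ p ≃ₜ* PiTp₂ p)
    (hΔ : (curve₂ p).DeltaTemp.map γ.toMulEquiv.toMonoidHom = (curve₂ p).DeltaTemp) (σ : Gam p) :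
    (γ (1, σ)).1 = 1 := by
  have hcen : (γ (1, σ)).1 ∈ Subgroup.center Gfp := by
    rw [Subgroup.mem_center_iff]
    intro y
    obtain ⟨x, hx⟩ := exists_fst_apply_mk_one_eq p γ hΔ y
    have hcomm : ((x, 1) : PiTp₂ p) * (1, σ) = (1, σ) * (x, 1) :=
      Prod.ext ((mul_one x).trans (one_mul x).symm) ((one_mul σ).trans (mul_one σ).symm)
    have h := congrArg (fun g => (γ g).1) hcomm
    simp only [map_mul, Prod.fst_mul, hx] at h
    exact h
  rw [center_gfp_eq_bot, Subgroup.mem_bot] at hcen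
  exact hcen

/-- **Product decomposition**: `γ (x, σ) = ((γ (x,1)).1, (γ (1,σ)).2)` for a `Δ`-preserving `γ`.
[cite: MochizukiEtTh2009, Thm 1.6 (i) p.24] -/
theorem apply_eq_prod (γ : PiTp₂ p ≃ₜ* PiTp₂ p)
    (hΔ : (curve₂ p).DeltaTemp.map γ.toMulEquiv.toMonoidHom = (curve₂ p).DeltaTemp) (g : PiTp₂ p) :
    γ g = ((γ (g.1, 1)).1, (γ (1, g.2)).2) := by
  have hg : g = ((g.1, 1) : PiTp₂ p) * (1, g.2) := Prod.ext (mul_one _).symm (one_mul _).symm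
  conv_lhs => rw [hg, map_mul]
  refine Prod.ext ?_ ?_
  · rw [Prod.fst_mul, fst_apply_one_mk p γ hΔ, mul_one]
  · rw [Prod.snd_mul, snd_apply_mk_one p γ hΔ, one_mul]

/-- The `Γ`-slice of a `Δ`-preserving topological automorphism of `Π^tp_X`, as a topological automorphism
of `Γ` (proof-internal packaging; the statement only asserts existence). [cite: MochizukiEtTh2009, Thm 1.6 (i) p.24] -/
theorem exists_slice (γ : PiTp₂ p ≃ₜ* PiTp₂ p)
    (hΔ : (curve₂ p).DeltaTemp.map γ.toMulEquiv.toMonoidHom = (curve₂ p).DeltaTemp) :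
    ∃ γ₁ : Gfp ≃ₜ* Gfp, ∀ x : Gfp, γ₁ x = (γ (x, 1)).1 := by
  have hΔ' := map_deltaTemp_symm_eq p γ hΔ
  have h1 : ∀ x : Gfp, γ (x, 1) = ((γ (x, 1)).1, 1) := fun x =>
    Prod.ext rfl (snd_apply_mk_one p γ hΔ x)
  have h2 : ∀ y : Gfp, γ.symm (y, 1) = ((γ.symm (y, 1)).1, 1) := fun y =>
    Prod.ext rfl (snd_apply_mk_one p γ.symm hΔ' y)
  let e : Gfp ≃* Gfp :=
    { toFun := fun x => (γ (x, 1)).1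
      invFun := fun y => (γ.symm (y, 1)).1
      left_inv := fun x => by
        show (γ.symm ((γ (x, 1)).1, 1)).1 = x
        rw [← h1 x, γ.symm_apply_apply]
      right_inv := fun y => by
        show (γ ((γ.symm (y, 1)).1, 1)).1 = y
        rw [← h2 y, γ.apply_symm_apply]
      map_mul' := fun x y => by
        show (γ (x * y, 1)).1 = (γ (x, 1)).1 * (γ (y, 1)).1
        rw [← Prod.fst_mul, ← map_mul]
        rfl }
  refine ⟨ContinuousMulEquiv.mk e ?_ ?_, fun x => rfl⟩
  · exact continuous_fst.comp (γ.continuous.comp (continuous_id.prodMk continuous_const))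
  · exact continuous_fst.comp (γ.symm.continuous.comp (continuous_id.prodMk continuous_const))

/-! ### 6. [EtTh] Thm. 1.6 (i) HOLDS at `ThetaSetting.model₂ p` -/

/-- `q_X = p²` lies in `ℚ_p`. [folklore] -/
private theorem qModel_mem_bot' : qModel p ∈ (⊥ : IntermediateField ℚ_[p] (PadicAlgCl p)) :=
  pow_mem (IntermediateField.natCast_mem ⊥ p) 2

/-- **`K₂ = ℚ_p(ζ₂, (p²)^{1/2}) = ℚ_p`**: square roots of `1` and of `q_X = p²` are `±1`, `±p ∈ ℚ_p`.
[cite: MochizukiEtTh2009, §1 p.13] -/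
theorem fieldKN_bot_qModel_two_mul_one : fieldKN ⊥ (qModel p) (2 * 1) = ⊥ := by
  unfold fieldKN
  refine le_antisymm (IntermediateField.adjoin_le_iff.mpr ?_) bot_le
  have h2 : (((2 * 1 : ℕ+) : ℕ)) = 2 := rfl
  have hp : ((p : ℕ) : PadicAlgCl p) ∈ (⊥ : IntermediateField ℚ_[p] (PadicAlgCl p)) := natCast_mem ⊥ p
  rintro x (hx | hx)
  · exact hx
  · rw [Set.mem_setOf_eq, h2] at hx
    rcases hx with hx | hx
    · rw [sq, mul_self_eq_one_iff] at hx
      rcases hx with rfl | rfl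
      · exact one_mem _
      · exact neg_mem (one_mem _)
    · change x ^ 2 = ((p : ℕ) : PadicAlgCl p) ^ 2 at hx
      rcases sq_eq_sq_iff_eq_or_eq_neg.mp hx with rfl | rfl
      · exact hp
      · exact neg_mem hp

/-- **`J̈₁ = ℚ_p`** at the finer model: `J̈₁ = K₂(a^{1/1})_{a ∈ K₂} = K₂ = ℚ_p`. [cite: MochizukiEtTh2009, §1 p.17] -/
theorem fieldJddN_bot_qModel_one : fieldJddN ⊥ (qModel p) 1 = ⊥ := by
  unfold fieldJddN
  rw [fieldKN_bot_qModel_two_mul_one]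
  refine le_antisymm (IntermediateField.adjoin_le_iff.mpr ?_) bot_le
  rintro x (hx | hx)
  · exact hx
  · simp only [PNat.one_coe, pow_one, Set.mem_setOf_eq] at hx
    exact hx

/-- `G_{K₂} = G_{ℚ_p}` inside the discrete copy `Γ_{arith}`. [cite: MochizukiEtTh2009, §1 p.13] -/
theorem gKN_two_mul_one_eq_top : gKN p (2 * 1) = ⊤ := by
  rw [gKN, fieldKN_bot_qModel_two_mul_one, IntermediateField.fixingSubgroup_bot, Subgroup.comap_top]

/-- **`Π^tp_Ÿ` of the finer model is `Δ^tp_{Y₂} × G_{ℚ_p}`**: `Π^tp_Ÿ = Π^tp_{Y₂} ∩ aug⁻¹(G_{J̈₁})` with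
`K₂ = J̈₁ = ℚ_p`. [cite: MochizukiEtTh2009, §1 p.17] -/
theorem mem_GtpYdd_model₂_iff (g : PiTp₂ p) :
    g ∈ (ThetaSetting.model₂ p).GtpYdd ↔ g.1 ∈ dY (2 * 1) := by
  change g ∈ YN₂ p (2 * 1) ⊓
      ((fieldJddN ⊥ (qModel p) 1).fixingSubgroup).comap (augM₂ p).toMonoidHom ↔ _
  rw [fieldJddN_bot_qModel_one, IntermediateField.fixingSubgroup_bot, Subgroup.comap_top, inf_top_eq,
    YN₂, gKN_two_mul_one_eq_top, Subgroup.mem_prod]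
  exact ⟨fun h => h.1, fun h => ⟨h, Subgroup.mem_top _⟩⟩

/-- **[EtTh] Thm. 1.6 (i) HOLDS at the finer model `ThetaSetting.model₂ p`**: for EVERY isomorphism of
topological groups `γ : Π^tp_X ⥲ Π^tp_X` preserving `Δ^tp_X` (the [AbsAnab] Lem. 1.3.8 input `hΔ`),
`γ(Π^tp_Ÿ) = Π^tp_Ÿ` (`ThetaSetting.Thm16i γ` at `Dα = Dβ = model₂ p`). No origin clause is consumed:
`Π^tp_Ÿ = Δ^tp_{Y₂} × G_{ℚ_p}`, `γ = γ₁ × α` (`Γ` centre-free), and `γ₁` preserves `Δ^tp_{Y₂}`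
(`map_dY_eq`). CONTRAST: at the discrete root model the swap `a ↔ b` refutes the same sentence
(`SettingModelThm16iIndependence.exists_deltaPreserving_not_thm16i`). [cite: MochizukiEtTh2009, Thm 1.6 (i) p.24] -/
theorem model₂_thm16i (γ : (ThetaSetting.model₂ p).PiTemp ≃ₜ* (ThetaSetting.model₂ p).PiTemp)
    (hΔ : (ThetaSetting.model₂ p).DeltaTemp.map γ.toMulEquiv.toMonoidHom =
      (ThetaSetting.model₂ p).DeltaTemp) :
    ThetaSetting.Thm16i γ := by
  have hΔ' := map_deltaTemp_symm_eq p γ hΔ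
  obtain ⟨γ₁, hγ₁⟩ := exists_slice p γ hΔ
  obtain ⟨δ₁, hδ₁⟩ := exists_slice p γ.symm hΔ'
  unfold ThetaSetting.Thm16i
  ext g
  rw [mem_GtpYdd_model₂_iff]
  constructor
  · rintro ⟨h, hh, rfl⟩
    have hh' : h.1 ∈ dY (2 * 1) := (mem_GtpYdd_model₂_iff p h).mp hh
    change (γ h).1 ∈ dY (2 * 1)
    rw [apply_eq_prod p γ hΔ h, ← hγ₁]
    exact (apply_mem_dY_iff γ₁ _ h.1).mpr hh'
  · intro hg
    refine ⟨γ.symm g, ?_, γ.apply_symm_apply g⟩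
    change γ.symm g ∈ (ThetaSetting.model₂ p).GtpYdd
    rw [mem_GtpYdd_model₂_iff, apply_eq_prod p γ.symm hΔ' g, ← hδ₁]
    exact (apply_mem_dY_iff δ₁ _ g.1).mpr hg

/-- **Root + guard + «Thm. 1.6 (i) for every `Δ`-preserving `γ`» are jointly satisfiable** — witnessed by
the finer model (whereas `IsThm16Origin` still fails there for want of a cusp, and at the discrete root
model Thm. 1.6 (i) itself fails). [cite: MochizukiEtTh2009, Thm 1.6 (i) p.24] -/
theorem _root_.Literature.AnabelianGeometry.EtaleTheta.ThetaSetting.exists_isEtThOrigin_and_forall_thm16i :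
    ∃ D : ThetaSetting p, D.IsEtThOrigin ∧
      ∀ γ : D.PiTemp ≃ₜ* D.PiTemp,
        D.DeltaTemp.map γ.toMulEquiv.toMonoidHom = D.DeltaTemp → ThetaSetting.Thm16i γ :=
  ⟨ThetaSetting.model₂ p, ThetaSetting.model₂_isEtThOrigin p, fun γ hΔ => model₂_thm16i p γ hΔ⟩

end Model

end Literature.AnabelianGeometry.EtaleTheta.SettingModel

end
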